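import Literature.MathematicalPhysics.QuantumFieldTheory.Balaban1983to89.Beta.RemainderDecay190TwoGrid
import Literature.MathematicalPhysics.QuantumFieldTheory.Balaban1983to89.B11Ineq190Actual
import Literature.MathematicalPhysics.QuantumFieldTheory.Balaban1983to89.B11Ineq73HasMajConcrete

/-!
# [Balaban1987RG1] p. 282 ⟵ [Balaban1985Variational] Prop. 9 (190): NODE D's socket `Data190` INHABITED BY THE ACTUAL
FRÉCHET DERIVATIVE `(δ/δB)𝓗(0)` OF THE (179) CHART on the two-grid carrier, MODULO EXACTLY the located Sect.-G leaves of
`B11Ineq190Actual` (`Beta.RemainderDecay190TwoGridActual`)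

HONEST FRAMING (cell rule, page 1 of everything).  Discharging `BetaPertH` makes Bałaban's UV stability UNCONDITIONAL —
a real constructive-QFT result; it is NOT the continuum limit and NOT the Clay problem.  This module discharges NOTHING
of `BetaPertH`.  It is the JUNCTION between two existing kernel objects of row (D4): lit-balaban r08's
`B11Ineq190Actual.ineq190_sectG` — [15] (190), entries n = 0, 1, for the GENUINE derivative
`D(chartH179 𝒢 W Δ⁽²⁾ H₀ (· − H(D ·)) ε₄)(B)` of the (179) chart `𝓗 = 𝒜₀ + H₀B − HD(𝒜₀ + H₀B)` at scheme level
(carriers `Eq182`/`Eq184`/`Bound188` THEOREMS there; the located leaves of print — (189) `h189` (author-omitted,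
G-B11-G2), the kernel letters of G̃ `hG`, H₀ `hH0`, H `hH`, 𝔇 `hDfr` ((73)), Δ⁽²⁾H₀ `hD2H0`, the smallness (187) `hq` —
HYPOTHESES there and here) — and this lineage's (190)-socket `RemainderDecay190.Data190` of the k-uniform remainder chain,
on the TWO-GRID carrier of `RemainderDecay190TwoGrid` (B-data on a point set `XB n` fibred over the unit cube-torus,
configurations on `XA n`, complex values, the sup sizes of (190) over the fibres of the M-cubes).  Result: NODE D
inhabited by the actual derivative AT THE ORIGIN `B = 0` ([I] (4.35): (δ/δB)𝐇_k(□₀, 0)), with the letter list carried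
verbatim and the scheme's two norm-compatibility letters `hN`, `hBloc` discharged on this carrier (lit-balaban's
`B11Ineq73HasMajConcrete`, by name).  Bookkeeping-grade
(a by-name junction); NOT summit progress.  The owner memo `HOME/b2b-balaban-beta-an4/FLAT-LETTERS-LOCATED.md` §§10–13
(generation 100) lists the in-tree candidates for each carried letter (flat: held; in a background: NE9's live
`B9Eq342*`; (189): none).

ABSOLUTE RULE (cell).  "No internally-minted statement may enter as a cited fact. Every hypothesis is either
kernel-proved in this package or a verbatim quotation of a PUBLISHED theorem with page reference. The manuscript(s)
under audit are NOT citable for their own disputed steps — they are the thing under adjudication; programme-internal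
(2001/route/tribunal) claims are never citable."  Every declaration below is a proved theorem; no `def` is introduced.

CITATION HEADER (lean-in-tree rule 2026-08-18).  [15] = T. Bałaban, *The variational problem and background fields in
renormalization group method for lattice gauge theories*, Commun. Math. Phys. **102**, 277–309 (1985)
[Balaban1985Variational] (held `paper:balaban1985-cmp102-variational-background`; PDF page = journal page − 276):
(179)–(180) p. 306, (182)–(190) pp. 307–308 (p. 308 verbatim: *"This inequality, the formula (188) and Lemma 2.1, and
finally Proposition 2 and (181), yield ∣(δ/δB_ν(y′))𝓗_μ(B,x)∣, … ≤ O(1)[(L^jη)^{−1}, …]·(L^{j′}η)^{−d} exp(−⅛δ₀d(y,y′))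
(190) for x ∈ Δ(y), … y ∈ Λ_j, y′ ∈ Λ_{j′}"*; (189) p. 308: *"We do not perform these calculations here"*), Prop. 9
p. 309 (*"… and its functional derivative (182) satisfies the inequalities (190)"*); [I] = T. Bałaban, *Renormalization
group approach to lattice gauge field theories. I*, Commun. Math. Phys. **109**, 249–301 (1987) [Balaban1987RG1],
p. 282, (4.35) p. 290, (4.4) p. 281; [3] = T. Bałaban, *Propagators and renormalization transformations for lattice
gauge theories. II*, Commun. Math. Phys. **96**, 223–250 (1984) [Balaban1984PropagatorsII], (2.46) p. 231, (2.54)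
p. 233, Lemma 2.1 (2.61) p. 234.  Read by generation 12 of this unit on the renders named in `RemainderDecay190`; the
(182)–(190) wordings agree with lit-balaban r08's `B11SectG` ∕ `B11Ineq190Actual`.

## What is PROVED here (kernel-checked; 0 sorry; no `def`)

(K1) `ineq190_mono` (the (190) letter: constant up, rate down).  The scheme's norm-compatibility letters on the sup
sizes (`hN`: a block sup size is ≤ the sup norm; `hBloc`: a function localised in the block of y′ has sup norm ≤ its
size at y′, boxes = fibres of the block map) are lit-balaban r12's `B11Ineq73HasMajConcrete.loc_le_norm_supSize` ∕
`norm_le_loc_of_isLoc`, imported BY NAME.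
(K2) **`exists_data190_twoGrid_actual`** — NODE D INHABITED BY THE ACTUAL DERIVATIVE AT THE ORIGIN: per volume index n
a Sect.-G scheme of `B11Eq183Differentiation` §5 ON THE TWO-GRID CARRIER (`𝒳 := XB n → ℂ`, `𝒴 := XA n → ℂ`, sup norms;
`𝒵 n` any complex Banach space; data `𝒢 n` (= G̃), `W n` (= (δ/δA′)V), `D2 n` (= Δ⁽²⁾), `H₀ n`, `H n`, the Sect. C
map `Dc n` with derivative `𝔇 n` at the point `𝒜₀(0) + H₀0`, a `Regime` with `0 < j n`, `0 < a n`), an auxiliary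
size `b3 n` on `𝒵 n`, and the located leaves with constants UNIFORM IN n at the [15]-rate `δ₀ > 0` (`hG`, `hD2H0`,
`hH0`, `hH`, `h189`, `hDfr`, `hq`), plus numerics (`c₀(⅛)^D ≤ c8` for Lemma 2.1 at ⅛δ₀; `q.δ15 ≤ δ₀`; `∀ n, const190 1 1
(b3 n).κ … c8 ≤ q.Cst`; the carrier numerics of `RemainderDecay190TwoGrid`) give
`∃ 𝒟 : Data190 D M N (fun n => XA n → ℂ) q` whose operator IS the actual derivative:
`𝒟.hn n X̄ y = (p ↦ cube(baseA n p) ∈ X̄ ? (D𝓗_n(0) δ_{σ n y})(p) : 0)`.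
(K3) **`fderiv_chartH179_zero_eq_H0`** — THE ZERO-BACKGROUND READING AT SCHEME LEVEL: if `Δ⁽²⁾H₀ = 0`, `DW = 0` at the base
point `𝒜₀(0) + H₀0` and the Sect. C map is stationary there (`𝔇 = 0`) — three statements about Bałaban's `V`, `Δ⁽²⁾`, `D` at
`U = 1`, CARRIED — then (184) forces `𝔄₀ = 0` and (182) gives `D𝓗(0) = H₀` (`eq184_sectG` ∕ `eq182_sectG` BY NAME): the letter
that the flat instance `RemainderDecay190TwoGridHk` feeds (`H₀ = H_k`) IS then the actual derivative of the chart.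

## What is NOT claimed

* None of the carried letters is discharged here: (189) is author-omitted in print (G-B11-G2); the propagator
  majorants `hG`, `hH0`, `hH`, `hDfr` in a background field are NE9's live work (`B9Eq342*`), flat versions are in the
  tree (`RemainderDecay190TwoGridHk` for `H₀ = H_k`); the words *"and finally Proposition 2 and (181)"* (transport
  from the base point, G-B11-G2a) are not typed anywhere; the scheme (`Regime`, `W` analytic, `V`) is NOT Bałaban's
  constructed effective action.  One sup size for all (4.4)-indices (entries n = 2, 3, 4 of (190) not separated).
* No `Literature` fact is minted; no `axiom`, no `sorry`.  NOT summit progress, NOT the continuum limit, NOT Clay.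
-/

namespace Literature.MathematicalPhysics.QuantumFieldTheory.Balaban1983to89.Beta.RemainderDecay190TwoGridActual

open Literature.MathematicalPhysics.QuantumFieldTheory.Balaban1983to89 B11SectG B6RandomWalk
open Literature.MathematicalPhysics.QuantumFieldTheory.Balaban1983to89.B9Thm34Ext (toB6)
open Literature.MathematicalPhysics.QuantumFieldTheory.Balaban1983to89.B9Thm37GlueTorus (torusGeom tdist1 tdist1_nonneg)
open Literature.MathematicalPhysics.QuantumFieldTheory.Balaban1983to89.B5TorusCover (UT)
open Literature.MathematicalPhysics.QuantumFieldTheory.Balaban1983to89.TreeLengthTorus (TPt TDom tsys)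
open Literature.MathematicalPhysics.QuantumFieldTheory.Balaban1983to89.B12Decay510Torus (pl1 tcubeOf geomT)
open Literature.MathematicalPhysics.QuantumFieldTheory.Balaban1983to89.B11SupSize190
  (supNorm supNorm_nonneg norm_le_supNorm supNorm_le supSize supSize_loc supSize_isLoc_iff)
open Literature.MathematicalPhysics.QuantumFieldTheory.Balaban1983to89.B11Eq174Chart (Regime)
open Literature.MathematicalPhysics.QuantumFieldTheory.Balaban1983to89.B11Eq183Differentiation
  (solA180 chartH179 eq182_sectG eq184_sectG)
open Literature.MathematicalPhysics.QuantumFieldTheory.Balaban1983to89.B11Ineq190Actual (ineq190_sectG)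
open Literature.MathematicalPhysics.QuantumFieldTheory.Balaban1983to89.B11Ineq73HasMajConcrete
  (loc_le_norm_supSize norm_le_loc_of_isLoc)
open Literature.MathematicalPhysics.QuantumFieldTheory.Balaban1983to89.Beta.RemainderDecay190 (Data190 Consts190)
open Literature.MathematicalPhysics.QuantumFieldTheory.Balaban1983to89.Beta.RemainderDecay190SectGTorus
  (hdist_torusGeom htri_torusGeom_family)
open Literature.MathematicalPhysics.QuantumFieldTheory.Balaban1983to89.Beta.RemainderRowSum (hrow_torusGeom)
open Literature.MathematicalPhysics.QuantumFieldTheory.Balaban1983to89.Beta.RemainderDecay190TwoGrid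
  (loc_supSize_single_le_one unitFieldsLocalised_supSize_single normDominated_supSize_restrict)

noncomputable section

variable {D : ℕ}

/-! ## 1. Monotonicity of the (190) letter (the scheme's norm-compatibility letters `hN` ∕ `hBloc` for the sup sizes are
lit-balaban's `B11Ineq73HasMajConcrete.loc_le_norm_supSize` ∕ `norm_le_loc_of_isLoc`, used by name in §2) -/

section Mono

variable {g : B6.Geometry} {FB FA : Type} [AddCommGroup FB] [Module ℝ FB] [AddCommGroup FA] [Module ℝ FA]

/-- The (190) letter is monotone: constant up, rate down (distances non-negative). [cite: Balaban1985Variational, (190) p.308] -/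
theorem ineq190_mono {bB : BlockNorm g FB} {bA : BlockNorm g FA} {T : FB →ₗ[ℝ] FA} {C C' δ δ' : ℝ}
    (h : Ineq190 bB bA T C δ) (hd : ∀ a b : g.Site, 0 ≤ g.dist a b) (hC : C ≤ C') (hC' : 0 ≤ C') (hδ : δ' ≤ δ) :
    Ineq190 bB bA T C' δ' := by
  refine h.mono fun y y' => ?_
  have hdist := hd y y'
  exact mul_le_mul hC (Real.exp_le_exp.mpr (by nlinarith)) (Real.exp_pos _).le hC'

end Mono

/-! ## 2. NODE D inhabited by the actual derivative of the (179) chart at the origin, modulo the located leaves -/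

section Socket

variable {Mc : ℕ} [NeZero Mc] {N : ℕ → ℕ} [∀ n, NeZero (N n)] {q : Consts190}

/-- **JOIN CERTIFICATE — NODE D BY THE ACTUAL DERIVATIVE `D𝓗(0)`, LETTERS CARRIED.**  Per volume index n: the
two-grid carrier of `RemainderDecay190TwoGrid` (B-data `XB n → ℂ` fibred over the unit cube-torus `TPt D (N n·M)` by
`baseB n` with a section `σ n`; configurations `XA n → ℂ` fibred by `baseA n`; sup sizes over the fibres
of the cubes; (4.4)-space `XA n → ℂ`); a Sect.-G scheme ON IT — `𝒢 n : 𝒵 n →L[ℂ] (XA n → ℂ)` (G̃), `W n` ((δ/δA′)V,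
analytic on `‖Y‖ < a₃ n`), `D2 n` (Δ⁽²⁾), `H₀ n`, `Hc n` (H of (46)), the Sect. C map `Dc n` with derivative `𝔇 n` at
`𝒜₀(0) + H₀0`, `Regime` (117)–(121) with `0 < j n`, `0 < a n`; an auxiliary size `b3 n` on `𝒵 n`; and the LOCATED
LEAVES at the [15]-rate `δ₀ > 0` with n-UNIFORM constants — `hG` (G̃), `hD2H0`, `hH0` (H₀, (129)), `hH` (H, (46)),
`h189` ((189) at `A′ = 𝒜₀(0) + H₀0`), `hDfr` ((73)), the Neumann smallness `hq` ((187)) — together with the numerics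
`c₀(δ₀, ⅛)^D ≤ c8` (Lemma 2.1 at ⅛δ₀), `0 < q.σ`, `c₀(δr, q.σ∕δr)^D ≤ q.cR`, `1 ≤ q.κB`, `q.δ15 ≤ δ₀`,
`∀ n, const190 1 1 (b3 n).κ BG θW cΔ A₀ AH θD c8 ≤ q.Cst`, `1 ≤ q.m`, `0 ≤ q.θ`, `q.θ·M ≤ 1`.  THEN
`∃ 𝒟 : Data190 D M N (fun n => XA n → ℂ) q` with `𝒟.hn n X̄ y = (p ↦ cube(baseA n p) ∈ X̄ ? (D𝓗_n(0) δ_{σ n y})(p) : 0)`,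
`𝓗_n = chartH179 (𝒢 n) (W n) (D2 n) (H₀ n) (· − Hc n (Dc n ·)) (ε₄ n)`.  `h190` := r08's `ineq190_sectG` at `B = 0` with
`hN` ∕ `hBloc` by `B11Ineq73HasMajConcrete`, (2.54) ∕ distances ∕ (2.61) by the site-torus lemmas; the dictionary by `RemainderDecay190TwoGrid` §3.
[cite: Balaban1985Variational, (179)-(190) pp.306-308, Prop. 9 p.309; Balaban1987RG1, p.282, (4.35) p.290, (4.4) p.281; Balaban1984PropagatorsII, (2.54) p.233, Lemma 2.1 (2.61) p.234] -/
theorem exists_data190_twoGrid_actual (I : Type) (i₀ : I) (η L Mg R : ℕ → ℝ) (Hh : ℕ → Prop)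
    (XB XA : ℕ → Type) [∀ n, Fintype (XB n)] [∀ n, Fintype (XA n)] [∀ n, DecidableEq (XB n)]
    (baseB : (n : ℕ) → XB n → TPt D (N n * Mc)) (baseA : (n : ℕ) → XA n → TPt D (N n * Mc))
    (σ : (n : ℕ) → TPt D (N n * Mc) → XB n) (hσ : ∀ n y, baseB n (σ n y) = y)
    (𝒵 : ℕ → Type) [∀ n, NormedAddCommGroup (𝒵 n)] [∀ n, NormedSpace ℂ (𝒵 n)] [∀ n, CompleteSpace (𝒵 n)]
    (𝒢 : (n : ℕ) → 𝒵 n →L[ℂ] (XA n → ℂ)) (W : (n : ℕ) → (XA n → ℂ) → 𝒵 n)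
    (D2 : (n : ℕ) → (XA n → ℂ) →L[ℂ] 𝒵 n) (H₀ Hc : (n : ℕ) → (XB n → ℂ) →L[ℂ] (XA n → ℂ))
    (Dc : (n : ℕ) → (XA n → ℂ) → (XB n → ℂ)) (𝔇 : (n : ℕ) → (XA n → ℂ) →L[ℂ] (XB n → ℂ))
    {B₀ θ C₄ a₃ j a ε₄ : ℕ → ℝ}
    (Rg : ∀ n, Regime (𝒢 n) 0 (W n) (B₀ n) (θ n) (C₄ n) (a₃ n) (j n) (a n) (ε₄ n))
    (hWa : ∀ n, AnalyticOnNhd ℂ (W n) {Y : XA n → ℂ | ‖Y‖ < a₃ n}) (hj : ∀ n, 0 < j n) (ha : ∀ n, 0 < a n)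
    (hDc : ∀ n, HasFDerivAt (Dc n) (𝔇 n) (solA180 (𝒢 n) (W n) (D2 n) (H₀ n) (ε₄ n) 0 + H₀ n 0))
    (b3 : (n : ℕ) → BlockNorm (toB6 (torusGeom (fun _ : Fin D => N n) (η n) (L n) (Mg n)) (R n) (Hh n)) (𝒵 n))
    {δ₀ BG θW cΔ A₀ AH θD c8 δr : ℝ} (hδ₀ : 0 < δ₀) (hBG : 0 ≤ BG) (hθW : 0 ≤ θW) (hcΔ : 0 ≤ cΔ) (hA₀ : 0 ≤ A₀)
    (hAH : 0 ≤ AH) (hθD : 0 ≤ θD) (hc8 : B6.c0 δ₀ (1 / 8) ^ D ≤ c8)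
    (hG : ∀ n, HasMaj (b3 n)
      (supSize (toB6 (torusGeom (fun _ : Fin D => N n) (η n) (L n) (Mg n)) (R n) (Hh n))
        (fun y => Finset.univ.filter fun p : XA n =>
          (fun i => (⟨(tcubeOf (N n) Mc (baseA n p) i).val, ZMod.val_lt (tcubeOf (N n) Mc (baseA n p) i)⟩ :
            Fin (N n))) = y)
        (fun p : XA n => fun i =>
          (⟨(tcubeOf (N n) Mc (baseA n p) i).val, ZMod.val_lt (tcubeOf (N n) Mc (baseA n p) i)⟩ : Fin (N n))) :
        BlockNorm (toB6 (torusGeom (fun _ : Fin D => N n) (η n) (L n) (Mg n)) (R n) (Hh n)) (XA n → ℂ))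
      ((𝒢 n).restrictScalars ℝ : 𝒵 n →ₗ[ℝ] (XA n → ℂ))
      (fun y y' => BG * Real.exp (-(δ₀ * tdist1 (fun _ : Fin D => N n) y y'))))
    (hD2H0 : ∀ n, HasMaj
      (supSize (toB6 (torusGeom (fun _ : Fin D => N n) (η n) (L n) (Mg n)) (R n) (Hh n))
        (fun y => Finset.univ.filter fun b : XB n =>
          (fun i => (⟨(tcubeOf (N n) Mc (baseB n b) i).val, ZMod.val_lt (tcubeOf (N n) Mc (baseB n b) i)⟩ :
            Fin (N n))) = y)
        (fun b : XB n => fun i =>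
          (⟨(tcubeOf (N n) Mc (baseB n b) i).val, ZMod.val_lt (tcubeOf (N n) Mc (baseB n b) i)⟩ : Fin (N n))) :
        BlockNorm (toB6 (torusGeom (fun _ : Fin D => N n) (η n) (L n) (Mg n)) (R n) (Hh n)) (XB n → ℂ))
      (b3 n) ((D2 n ∘L H₀ n).restrictScalars ℝ : (XB n → ℂ) →ₗ[ℝ] 𝒵 n)
      (fun y y' => cΔ * Real.exp (-(δ₀ * tdist1 (fun _ : Fin D => N n) y y'))))
    (hH0 : ∀ n, HasMaj
      (supSize (toB6 (torusGeom (fun _ : Fin D => N n) (η n) (L n) (Mg n)) (R n) (Hh n))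
        (fun y => Finset.univ.filter fun b : XB n =>
          (fun i => (⟨(tcubeOf (N n) Mc (baseB n b) i).val, ZMod.val_lt (tcubeOf (N n) Mc (baseB n b) i)⟩ :
            Fin (N n))) = y)
        (fun b : XB n => fun i =>
          (⟨(tcubeOf (N n) Mc (baseB n b) i).val, ZMod.val_lt (tcubeOf (N n) Mc (baseB n b) i)⟩ : Fin (N n))) :
        BlockNorm (toB6 (torusGeom (fun _ : Fin D => N n) (η n) (L n) (Mg n)) (R n) (Hh n)) (XB n → ℂ))
      (supSize (toB6 (torusGeom (fun _ : Fin D => N n) (η n) (L n) (Mg n)) (R n) (Hh n))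
        (fun y => Finset.univ.filter fun p : XA n =>
          (fun i => (⟨(tcubeOf (N n) Mc (baseA n p) i).val, ZMod.val_lt (tcubeOf (N n) Mc (baseA n p) i)⟩ :
            Fin (N n))) = y)
        (fun p : XA n => fun i =>
          (⟨(tcubeOf (N n) Mc (baseA n p) i).val, ZMod.val_lt (tcubeOf (N n) Mc (baseA n p) i)⟩ : Fin (N n))) :
        BlockNorm (toB6 (torusGeom (fun _ : Fin D => N n) (η n) (L n) (Mg n)) (R n) (Hh n)) (XA n → ℂ))
      ((H₀ n).restrictScalars ℝ : (XB n → ℂ) →ₗ[ℝ] (XA n → ℂ))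
      (fun y y' => A₀ * Real.exp (-(δ₀ * tdist1 (fun _ : Fin D => N n) y y'))))
    (hH : ∀ n, HasMaj
      (supSize (toB6 (torusGeom (fun _ : Fin D => N n) (η n) (L n) (Mg n)) (R n) (Hh n))
        (fun y => Finset.univ.filter fun b : XB n =>
          (fun i => (⟨(tcubeOf (N n) Mc (baseB n b) i).val, ZMod.val_lt (tcubeOf (N n) Mc (baseB n b) i)⟩ :
            Fin (N n))) = y)
        (fun b : XB n => fun i =>
          (⟨(tcubeOf (N n) Mc (baseB n b) i).val, ZMod.val_lt (tcubeOf (N n) Mc (baseB n b) i)⟩ : Fin (N n))) :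
        BlockNorm (toB6 (torusGeom (fun _ : Fin D => N n) (η n) (L n) (Mg n)) (R n) (Hh n)) (XB n → ℂ))
      (supSize (toB6 (torusGeom (fun _ : Fin D => N n) (η n) (L n) (Mg n)) (R n) (Hh n))
        (fun y => Finset.univ.filter fun p : XA n =>
          (fun i => (⟨(tcubeOf (N n) Mc (baseA n p) i).val, ZMod.val_lt (tcubeOf (N n) Mc (baseA n p) i)⟩ :
            Fin (N n))) = y)
        (fun p : XA n => fun i =>
          (⟨(tcubeOf (N n) Mc (baseA n p) i).val, ZMod.val_lt (tcubeOf (N n) Mc (baseA n p) i)⟩ : Fin (N n))) :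
        BlockNorm (toB6 (torusGeom (fun _ : Fin D => N n) (η n) (L n) (Mg n)) (R n) (Hh n)) (XA n → ℂ))
      ((Hc n).restrictScalars ℝ : (XB n → ℂ) →ₗ[ℝ] (XA n → ℂ))
      (fun y y' => AH * Real.exp (-(δ₀ / 2 * tdist1 (fun _ : Fin D => N n) y y'))))
    (h189 : ∀ n, Ineq189
      (supSize (toB6 (torusGeom (fun _ : Fin D => N n) (η n) (L n) (Mg n)) (R n) (Hh n))
        (fun y => Finset.univ.filter fun p : XA n =>
          (fun i => (⟨(tcubeOf (N n) Mc (baseA n p) i).val, ZMod.val_lt (tcubeOf (N n) Mc (baseA n p) i)⟩ :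
            Fin (N n))) = y)
        (fun p : XA n => fun i =>
          (⟨(tcubeOf (N n) Mc (baseA n p) i).val, ZMod.val_lt (tcubeOf (N n) Mc (baseA n p) i)⟩ : Fin (N n))) :
        BlockNorm (toB6 (torusGeom (fun _ : Fin D => N n) (η n) (L n) (Mg n)) (R n) (Hh n)) (XA n → ℂ))
      (b3 n)
      ((fderiv ℂ (W n) (solA180 (𝒢 n) (W n) (D2 n) (H₀ n) (ε₄ n) 0 + H₀ n 0)).restrictScalars ℝ :
        (XA n → ℂ) →ₗ[ℝ] 𝒵 n) θW δ₀)
    (hDfr : ∀ n, HasMaj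
      (supSize (toB6 (torusGeom (fun _ : Fin D => N n) (η n) (L n) (Mg n)) (R n) (Hh n))
        (fun y => Finset.univ.filter fun p : XA n =>
          (fun i => (⟨(tcubeOf (N n) Mc (baseA n p) i).val, ZMod.val_lt (tcubeOf (N n) Mc (baseA n p) i)⟩ :
            Fin (N n))) = y)
        (fun p : XA n => fun i =>
          (⟨(tcubeOf (N n) Mc (baseA n p) i).val, ZMod.val_lt (tcubeOf (N n) Mc (baseA n p) i)⟩ : Fin (N n))) :
        BlockNorm (toB6 (torusGeom (fun _ : Fin D => N n) (η n) (L n) (Mg n)) (R n) (Hh n)) (XA n → ℂ))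
      (supSize (toB6 (torusGeom (fun _ : Fin D => N n) (η n) (L n) (Mg n)) (R n) (Hh n))
        (fun y => Finset.univ.filter fun b : XB n =>
          (fun i => (⟨(tcubeOf (N n) Mc (baseB n b) i).val, ZMod.val_lt (tcubeOf (N n) Mc (baseB n b) i)⟩ :
            Fin (N n))) = y)
        (fun b : XB n => fun i =>
          (⟨(tcubeOf (N n) Mc (baseB n b) i).val, ZMod.val_lt (tcubeOf (N n) Mc (baseB n b) i)⟩ : Fin (N n))) :
        BlockNorm (toB6 (torusGeom (fun _ : Fin D => N n) (η n) (L n) (Mg n)) (R n) (Hh n)) (XB n → ℂ))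
      ((𝔇 n).restrictScalars ℝ : (XA n → ℂ) →ₗ[ℝ] (XB n → ℂ))
      (fun y y' => θD * Real.exp (-(δ₀ / 2 * tdist1 (fun _ : Fin D => N n) y y'))))
    (hq : ∀ n, qG (b3 n).κ 1 BG θW c8 < 1)
    (hδr : 0 < δr) (hσ₀ : 0 < q.σ) (hcR : B6.c0 δr (q.σ / δr) ^ D ≤ q.cR) (hκB : 1 ≤ q.κB)
    (hδ15 : q.δ15 ≤ δ₀) (hCst : ∀ n, const190 1 1 (b3 n).κ BG θW cΔ A₀ AH θD c8 ≤ q.Cst) (hm1 : 1 ≤ q.m)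
    (hθ : 0 ≤ q.θ) (hθM : q.θ * Mc ≤ 1) :
    ∃ 𝒟 : Data190 D Mc N (fun n => XA n → ℂ) q,
      ∀ (n : ℕ) (X : TDom D (N n)) (y : TPt D (N n * Mc)),
        𝒟.hn n X y = fun p : XA n =>
          if tcubeOf (N n) Mc (baseA n p) ∈ X.1 then
            (fderiv ℂ (chartH179 (𝒢 n) (W n) (D2 n) (H₀ n) (fun Y : XA n → ℂ => Y - Hc n (Dc n Y)) (ε₄ n)) 0
              (Pi.single (σ n y) (1 : ℂ))) p
          else 0 := by
  -- the row sum (2.61) at the rate ⅛δ₀ on the site tori, one constant for all n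
  have hrow8 : ∀ n, RowSum (toB6 (torusGeom (fun _ : Fin D => N n) (η n) (L n) (Mg n)) (R n) (Hh n)) (δ₀ / 8) c8 := by
    have e : δ₀ / 8 / δ₀ = 1 / 8 := by field_simp
    have hc8' : B6.c0 δ₀ (δ₀ / 8 / δ₀) ^ D ≤ c8 := by rw [e]; exact hc8
    exact hrow_torusGeom (fun n (_ : Fin D) => N n) η L Mg R Hh hδ₀ (by positivity) hc8'
  have hc8nn : 0 ≤ c8 := le_trans (pow_nonneg (by unfold B6.c0; exact tsum_nonneg fun z => (Real.exp_pos _).le) _) hc8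
  refine
    ⟨{ I := I, gn := fun n => toB6 (torusGeom (fun _ : Fin D => N n) (η n) (L n) (Mg n)) (R n) (Hh n),
       FBn := fun n => XB n → ℂ, FAn := fun n => XA n → ℂ,
       bBn := fun n => (supSize (toB6 (torusGeom (fun _ : Fin D => N n) (η n) (L n) (Mg n)) (R n) (Hh n))
         (fun y => Finset.univ.filter fun b : XB n =>
           (fun i => (⟨(tcubeOf (N n) Mc (baseB n b) i).val, ZMod.val_lt (tcubeOf (N n) Mc (baseB n b) i)⟩ :
             Fin (N n))) = y)
         (fun b : XB n => fun i =>
           (⟨(tcubeOf (N n) Mc (baseB n b) i).val, ZMod.val_lt (tcubeOf (N n) Mc (baseB n b) i)⟩ : Fin (N n))) :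
         BlockNorm (toB6 (torusGeom (fun _ : Fin D => N n) (η n) (L n) (Mg n)) (R n) (Hh n)) (XB n → ℂ)),
       boutn := fun n _ => (supSize (toB6 (torusGeom (fun _ : Fin D => N n) (η n) (L n) (Mg n)) (R n) (Hh n))
         (fun y => Finset.univ.filter fun p : XA n =>
           (fun i => (⟨(tcubeOf (N n) Mc (baseA n p) i).val, ZMod.val_lt (tcubeOf (N n) Mc (baseA n p) i)⟩ :
             Fin (N n))) = y)
         (fun p : XA n => fun i =>
           (⟨(tcubeOf (N n) Mc (baseA n p) i).val, ZMod.val_lt (tcubeOf (N n) Mc (baseA n p) i)⟩ : Fin (N n))) :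
         BlockNorm (toB6 (torusGeom (fun _ : Fin D => N n) (η n) (L n) (Mg n)) (R n) (Hh n)) (XA n → ℂ)),
       dHn := fun n => ((fderiv ℂ (chartH179 (𝒢 n) (W n) (D2 n) (H₀ n) (fun Y : XA n → ℂ => Y - Hc n (Dc n Y))
         (ε₄ n)) 0).restrictScalars ℝ : (XB n → ℂ) →ₗ[ℝ] (XA n → ℂ)),
       blkn := fun n X => (X.1.image fun a : TPt D (N n) => fun i => (⟨(a i).val, ZMod.val_lt (a i)⟩ : Fin (N n)) :
         Finset (UT (fun _ : Fin D => N n))),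
       ιn := fun n X A p => if tcubeOf (N n) Mc (baseA n p) ∈ X.1 then A p else 0,
       un := fun n y => Pi.single (σ n y) (1 : ℂ),
       h190 := fun n _ => ?_,
       hdist := hdist_torusGeom (fun n (_ : Fin D) => N n) η L Mg R Hh,
       hrow := hrow_torusGeom (fun n (_ : Fin D) => N n) η L Mg R Hh hδr hσ₀ hcR,
       hκB := fun _ => hκB,
       hdom := fun n => normDominated_supSize_restrict (baseA n) i₀,
       hm := fun n y y' => (loc_supSize_single_le_one
         (g := toB6 (torusGeom (fun _ : Fin D => N n) (η n) (L n) (Mg n)) (R n) (Hh n)) (σ n y) y').trans hm1,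
       hD := fun n => unitFieldsLocalised_supSize_single (baseB n) (σ n) (hσ n) hθ hθM },
      fun _ _ _ => rfl⟩
  -- typeclass synthesis does not unfold `toB6`: name the block torus's decidable equality on `g.Site`
  letI : DecidableEq (toB6 (torusGeom (fun _ : Fin D => N n) (η n) (L n) (Mg n)) (R n) (Hh n)).Site :=
    inferInstanceAs (DecidableEq (UT (fun _ : Fin D => N n)))
  have hJ : ‖D2 n (H₀ n 0)‖ < j n := by rw [map_zero, map_zero, norm_zero]; exact hj n
  have h𝔄 : ‖H₀ n 0‖ < a n := by rw [map_zero, norm_zero]; exact ha n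
  have h190 := ineq190_sectG (Rg n) (hWa n) hJ h𝔄 (Hc n) (hDc n)
    (fun y v => loc_le_norm_supSize _ y v) (fun y' μ hμ => norm_le_loc_of_isLoc _ y' μ hμ)
    (htri_torusGeom_family (fun n (_ : Fin D) => N n) η L Mg R Hh n)
    (hdist_torusGeom (fun n (_ : Fin D) => N n) η L Mg R Hh n) hδ₀.le (hrow8 n) hc8nn hBG hθW hcΔ hA₀ hAH hθD
    (hG n) (h189 n) (hD2H0 n) (hH0 n) (hH n) (hDfr n) (hq n)
  -- `0 ≤ const190 1 1 κ₃ …` from the explicit formula ((constA0 + A₀)·(1 + κ_B A_H κ_N θ_𝔇 c²), all factors ≥ 0)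
  have hCnn : 0 ≤ q.Cst := by
    refine le_trans ?_ (hCst n)
    have hA0 : 0 ≤ constA0 (b3 n).κ 1 BG θW cΔ A₀ c8 :=
      constA0_nonneg (b3 n).κ_nonneg zero_le_one hBG hθW hcΔ hA₀ hc8nn (hq n)
    unfold const190
    exact mul_nonneg (add_nonneg hA0 hA₀) (by positivity)
  exact ineq190_mono h190 (hdist_torusGeom (fun n (_ : Fin D) => N n) η L Mg R Hh n) (hCst n) hCnn hδ15

end Socket

/-! ## 3. The zero-background reading at scheme level: at the trivial point the actual derivative IS `H₀` -/

section Trivial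

variable {𝒳 𝒴 𝒵 : Type} [NormedAddCommGroup 𝒳] [NormedSpace ℂ 𝒳] [NormedAddCommGroup 𝒴] [NormedSpace ℂ 𝒴]
  [NormedAddCommGroup 𝒵] [NormedSpace ℂ 𝒵] [CompleteSpace 𝒳] [CompleteSpace 𝒴] [CompleteSpace 𝒵]
  {𝒢 : 𝒵 →L[ℂ] 𝒴} {W : 𝒴 → 𝒵} {D2 : 𝒴 →L[ℂ] 𝒵} {H₀ : 𝒳 →L[ℂ] 𝒴} {B₀ θ C₄ a₃ j a ε₄ : ℝ}

/-- **AT THE TRIVIAL SCHEME POINT THE ACTUAL DERIVATIVE OF THE (179) CHART IS `H₀`** — the memo's zero-background reading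
(«at `B = 0`, `U = 1`: `𝔄₀ = 0`, `𝔇 = 0`, hence `(δ/δB)𝓗 = H₀`», `HOME/b2b-balaban-beta-an4/FLAT-LETTERS-LOCATED.md` §§8, 13) AS A
KERNEL STATEMENT AT SCHEME LEVEL: if the second-order piece kills `H₀` (`Δ⁽²⁾H₀ = 0`), the second variation of `V` vanishes
at the base point `𝒜₀(0) + H₀0` (`fderiv W = 0` there — `V` of third order at a flat background) and the Sect. C map is
stationary there (`𝔇 = 0`), then (184) forces `𝔄₀ = (δ/δB)𝒜₀(0) = 0` and (182) gives `(δ/δB)𝓗(0) = H₀`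
(`B11Eq183Differentiation.eq184_sectG` ∕ `eq182_sectG` BY NAME).  The three vanishing hypotheses are statements about
Bałaban's `V`, `Δ⁽²⁾`, `D` at `U = 1`, CARRIED, not proved. [cite: Balaban1985Variational, (179)-(180) p.306, (182)-(184) p.307, (129) p.298] -/
theorem fderiv_chartH179_zero_eq_H0 (R : Regime 𝒢 0 W B₀ θ C₄ a₃ j a ε₄) (hWa : AnalyticOnNhd ℂ W {Y : 𝒴 | ‖Y‖ < a₃})
    (hj : 0 < j) (ha : 0 < a) (H : 𝒳 →L[ℂ] 𝒴) {Dc : 𝒴 → 𝒳}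
    (hDc : HasFDerivAt Dc (0 : 𝒴 →L[ℂ] 𝒳) (solA180 𝒢 W D2 H₀ ε₄ 0 + H₀ 0))
    (hD2 : D2 ∘L H₀ = 0) (hW : fderiv ℂ W (solA180 𝒢 W D2 H₀ ε₄ 0 + H₀ 0) = 0) :
    ((fderiv ℂ (chartH179 𝒢 W D2 H₀ (fun Y : 𝒴 => Y - H (Dc Y)) ε₄) 0).restrictScalars ℝ : 𝒳 →ₗ[ℝ] 𝒴) =
      (H₀.restrictScalars ℝ : 𝒳 →ₗ[ℝ] 𝒴) := by
  have hJ : ‖D2 (H₀ 0)‖ < j := by rw [map_zero, map_zero, norm_zero]; exact hj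
  have h𝔄 : ‖H₀ 0‖ < a := by rw [map_zero, norm_zero]; exact ha
  have h184 := eq184_sectG R hWa hJ h𝔄
  have h182 := eq182_sectG R hWa hJ h𝔄 H hDc
  unfold B11SectG.Eq184 at h184
  unfold B11SectG.Eq182 at h182
  rw [hW, hD2] at h184
  simp only [ContinuousLinearMap.restrictScalars_zero, ContinuousLinearMap.toLinearMap_zero, LinearMap.comp_zero,
    LinearMap.zero_comp, sub_zero, add_zero] at h184
  rw [h182, h184]
  simp only [ContinuousLinearMap.restrictScalars_zero, ContinuousLinearMap.toLinearMap_zero, LinearMap.comp_zero,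
    LinearMap.zero_comp, zero_add, sub_zero]

end Trivial

end

end Literature.MathematicalPhysics.QuantumFieldTheory.Balaban1983to89.Beta.RemainderDecay190TwoGridActual
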